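import Summits.QuantumFields.YangMills.Theorems.BalabanUVNodesK2NamedJetsRunRemAt
import Literature.MathematicalPhysics.QuantumFieldTheory.Balaban1983to89.T4BetaStationary

/-!
# Crux K2⁷ `EndpointGivenBR13SepCoPH` (stmt-QuantumFields-20543), LINE 2 — THE v₀-FREE CORNER ROAD, PORTED (hypothesis form; 0 `def`, 0 `sorry`): N17 `ScaleShiftRate` + the
# per-scale ANCHOR `ScaleAnchor` MANUFACTURE DEF-1's constant remainder at EVERY height; with `HistLipschitz` they give the letters `RemAt` ∕ `RunRemAt F κ θ hP θ.cβ` per tuple;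
# the three-stub line {U3ᴷ, Anchorᴷ, (D1)} and its sign twin conclude the crux decl BY NAME

Cell `ym-nodeO-ideate`, PROVER seat `ym-nodeO-port-1` (director-ym №206 (3) ∕ R393 (a): «port the v₀-free corner road (CRIT-2 2c∕2e + idea-7) to `Theorems/` in hypothesis form
`--supports 20543`»; plan g82 YMPLAN-G82-DECISION-204 (2): K2⁷'s LINE 2 is re-registered (v7) only against LANDED decls).  Helper for crux K2⁷ = stmt-QuantumFields-20543
(`--supports … --as helper`); count-neutral; NO skeleton is registered by this file.
AUTHORSHIP ∕ ATTRIBUTION.  The mathematics and most of the Lean text are idea-7's (`Cruxes/EndpointGivenBR13SepCoPH/CornerLimitSignSketch.lean` ed.3 e928afe3fe73, seats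
planner-ym-nodeO-idea-7 g2–g4: §1 corner step ∕ telescoping ∕ every-slope, §8.1 `constRemainder_of_scaleShiftRate_cornerAnchor`, §8.2 Cesàro junction, §8.3∕8.7 `remAt_of_letters_scaleAnchor`
and the three-stub concluders) and CRIT-2's (ROUND 2c J2 «`ScaleAnchor ⟺ CornerAnchor`», 2e §B texts `AnchorSomeJets13` ∕ `D1SignShadowingAnchor13`, 2f «v6∕v7 LINE 2 := {U3TripleK,
AnchorSomeJets13K, the registered (D1) stub}»), over DEF-1's letters `ConstRemainder` ∕ `ScaleAnchor` ∕ `RemAt` (p593586) ∕ `RunRemAt` (p596574).  This seat's part: the port RE-BASED ON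
DEF-1's `ScaleAnchor` throughout (idea-7's `CornerAnchor` is not re-declared — J2 makes it redundant, `ScaleAnchor.eq` replaces `cornerAnchor_unique`), the sign road routed through
DEF-1's box consumer `endpointExistence_of_drift_constRemainder_cont` BY NAME (`oneLoopDrift_of_geometric`: N17's geometric convergence of the corner values IS a two-sided drift at
the limit slope — the sign twin and the drift line share ONE consumer), every text spelled INLINE at v6's full-prefix keying (no parameterless `def … : Prop` under `Theorems/`).

THE ROAD (CRIT-2 2c∕2e∕2f + idea-7 §8; BN-F placement per CRIT-1 g4 addendum §2: the line's only box-wide ∀k letters are K3⁷'s own — K3's typing call; the identification and the (D1)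
rows are NOT HIT).  Per tuple `(F, θ, hP)`, `D := Node00.datumOfRecord₁₃SepCoPH F 2 θ hP`: K3⁷'s letters on `D.βfun` (RHS of the landed read-out `iff`
`BalabanUVNodesN17D4ReadOutAtRecord13.exists_u3Objects₁₁_readOut_n18_n22_datumOfRecord₁₃CoPH_iff`) — N17 `ScaleShiftRate c ρ θ.γ`, `0 ≤ ρ < 1`, the history moduli
`HistLipschitz Λ θ.γ`; THE IDENTIFICATION (K2⁷-private XL = NODE O's located wall; M per k, ∃κ AFTER θ, `θ.cβ` carried) `ScaleAnchor D.βfun (fun k => θ.cβ * beta0OfJs F κ k)`; row (D1)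
as the DRIFT `OneLoopDrift (stepBal 2 F.L) A (beta0OfJs F κ)` (v6's registered 1ᴬ `D1AtAnchoredJets`) or as the EVENTUAL SIGN `b⁰_k ≥ e > 0`.
§1 (generic): N17 + anchor ⟹ corner step `|b_{k+1} − b_k| ≤ c ρ^k`, geometric convergence, and by telescoping `ConstRemainder β b s γ_s` at EVERY `s > 0` on some `0 < γ_s ≤ γ`
(★ `constRemainder_of_scaleShiftRate_scaleAnchor`; the cap of `RemAt` is then met with `le_rfl`, t-SLACK moot); the Cesàro junction (drift ⟹ the named numbers tend TO the slope ⟹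
eventual sign: the sign text is the WEAKER ask); ★ `endpointExistence_of_letters_scaleAnchor_eventuallyPos` (the sign road's END through DEF-1's consumer).
§2 (at the record, pointwise use forms for a LINE-2 skeleton): ★ `remAt_of_letters_scaleAnchor` ∕ `runRemAt_of_letters_scaleAnchor` (the XL letters of lines 1′∕1ᴮ″ MANUFACTURED),
★ `endpointExistence_of_letters_scaleAnchor_drift` ∕ `…_sign`, `eventuallyPos_of_letters_scaleAnchor_drift`.
§3 (texts INLINE at v6's keying `(unity ∧ slots) → Admissible → (B) → window`; 1ᴬ ∕ 2ᴮ″ VERBATIM v6 5a75a2378c79b303 :330 `D1AtAnchoredJets` ∕ :319 `RunRemAtSomeJets` with `Window13`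
unfolded; U3ᴷ ∕ Anchorᴷ ∕ Signᴷ = idea-7 §8.7 `U3TripleAtRecord13K` ∕ `AnchorSomeJets13K` ∕ `D1SignShadowingAnchor13K`): ★★★ `EndpointGivenBR13SepCoPH_of_u3K_anchorK_d1AnchoredK` (THE LINE:
U3ᴷ → Anchorᴷ → 1ᴬ → crux decl BY NAME), ★★★ `…_of_u3K_anchorK_signK` (sign twin), ★★ `runRemAtSomeJetsK_of_u3K_anchorK` (v6's REGISTERED XL text 2ᴮ″ DISCHARGED modulo U3ᴷ + Anchorᴷ —
the locating implication; converse projection `anchorK_of_runRemAtSomeJetsK`), `signK_of_u3K_d1AnchoredK` (1ᴬ ⟹ Signᴷ given U3ᴷ).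

HONEST FRAMING.  Implications between displayed HYPOTHESIS SHAPES and elementary real bookkeeping; NOTHING of Bałaban's analysis is asserted or discharged: N17, the history
moduli, the identification, the drift and the sign are hypotheses inhabited at no θ here (instance 0∕1); K2⁷ ∕ K3⁷ ∕ NODE O NOT proved (skeleton of record v6: 2 registered stubs,
0 closed; LINE 2 unregistered); counts unmoved; [Balaban1987RG1] Thm 2 + (0.31) p. 259 is UNPROVED IN PRINT; route R4 closes the CONDITIONAL finite-𝕋⁴ rung `BalabanLadder.UV`
only — NOT the continuum limit, NOT ℝ⁴, NOT OS, NOT the Yang–Mills mass gap, NOT Clay.  No `def`, no `instance`, no `notation`, no `axiom`.  Sources (context only; nothing printed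
is used as a hypothesis): [I] = [Balaban1987RG1] CMP **109** (1987): Thm 2 p. 259 (first sentence), (1.3) p. 260, (1.20)–(1.22) p. 264, Thm 3 p. 264, (2.9) p. 266, (2.12)–(2.14)
p. 268, (5.10) p. 293; [II] = [Balaban1988RG2Cluster] CMP **116** (1988): Lemma 3 (2.38) p. 20.
-/

noncomputable section

namespace Summit.QuantumFields.YangMills.Theorems.BalabanUVNodesK2CornerRoad

open Filter Topology Finset
open Literature.MathematicalPhysics.QuantumFieldTheory.Balaban1983to89
open Literature.MathematicalPhysics.QuantumFieldTheory.Balaban1983to89.FlowStep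
open Literature.MathematicalPhysics.QuantumFieldTheory.Balaban1983to89.DagBinding (EndpointExistence ForwardGenerated)
open Literature.MathematicalPhysics.QuantumFieldTheory.Balaban1983to89.T4Continuum (T4Family)
open Literature.MathematicalPhysics.QuantumFieldTheory.Balaban1983to89.T4CouplingMatching (ScaleShiftRate HistLipschitz)
open Literature.MathematicalPhysics.QuantumFieldTheory.Balaban1983to89.Beta.Drift (OneLoopDrift)
open Summit.QuantumFields.YangMills.Theorems.BalabanUVNodesK2JsOfRecord (StepColourData beta0OfJs)
open Summit.QuantumFields.YangMills.Theorems.BalabanUVNodesK2NamedJetsRemAt (RemAt ConstRemainder ScaleAnchor endpointExistence_of_remAt_drift endpointExistence_of_drift_constRemainder_cont)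
open Summit.QuantumFields.YangMills.Theorems.BalabanUVNodesK2NamedJetsRunRemAt (RunRemAt runRemAt_of_remAt)

/-! ## §1 Generic: N17 + DEF-1's per-scale anchor ⟹ corner step, geometric convergence, the constant remainder at EVERY height; the Cesàro junction; the sign road's END -/

section Generic

variable {β : HBeta} {b : ℕ → ℝ}

/-- DEF-1's per-scale anchor READ ON `FlowStep.Box` (the same set as `B12Beta.HistBox`, `histBox_eq_box`; CRIT-2 ROUND 2c J2). [folklore] -/
theorem scaleAnchor_on_box (hb : ScaleAnchor β b) (k : ℕ) {ε : ℝ} (hε : 0 < ε) : ∃ δ : ℝ, 0 < δ ∧ ∀ v ∈ Box δ k, |β k v - b k| ≤ ε := by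
  obtain ⟨δ, hδ, h⟩ := hb k ε hε
  exact ⟨δ, hδ, fun v hv => h v (by rw [histBox_eq_box]; exact hv)⟩

/-- Finitely many scales at once (min of finitely many anchoring radii). [folklore] -/
theorem scaleAnchor_upTo (hb : ScaleAnchor β b) (k₀ : ℕ) {ε : ℝ} (hε : 0 < ε) :
    ∃ δ : ℝ, 0 < δ ∧ ∀ k, k ≤ k₀ → ∀ v ∈ Box δ k, |β k v - b k| ≤ ε := by
  induction k₀ with
  | zero =>
    obtain ⟨δ, hδ, h⟩ := scaleAnchor_on_box hb 0 hε
    exact ⟨δ, hδ, fun k hk v hv => by obtain rfl := Nat.le_zero.mp hk; exact h v hv⟩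
  | succ n ih =>
    obtain ⟨δ, hδ, h⟩ := ih
    obtain ⟨δ', hδ', h'⟩ := scaleAnchor_on_box hb (n + 1) hε
    refine ⟨min δ δ', lt_min hδ hδ', fun k hk v hv => ?_⟩
    rcases Nat.lt_or_ge k (n + 1) with hlt | hge
    · exact h k (Nat.lt_succ_iff.mp hlt) v (box_mono (min_le_left _ _) k hv)
    · obtain rfl := le_antisymm hk hge
      exact h' v (box_mono (min_le_right _ _) _ hv)

/-- **CORNER STEP**: N17 (`ScaleShiftRate c ρ γ β`) evaluated at the corner bounds the step of the anchoring numbers, `|b_{k+1} − b_k| ≤ c·ρ^k` (test history: the diagonal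
`(t,…,t)` below `γ` and both anchoring radii). [cite: Balaban1987RG1, (1.20)-(1.22) p.264 and (2.13) p.268] -/
theorem abs_step_le_of_scaleShiftRate_scaleAnchor {c ρ γ : ℝ} (hγ : 0 < γ) (hb : ScaleAnchor β b) (h : ScaleShiftRate c ρ γ β) (k : ℕ) :
    |b (k + 1) - b k| ≤ c * ρ ^ k := by
  refine le_of_forall_pos_le_add fun ε hε => ?_
  obtain ⟨γ₁, hγ₁, hA₁⟩ := scaleAnchor_on_box hb (k + 1) (half_pos hε)
  obtain ⟨γ₀, hγ₀, hA₀⟩ := scaleAnchor_on_box hb k (half_pos hε)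
  have ht0 : 0 < min γ (min γ₁ γ₀) := lt_min hγ (lt_min hγ₁ hγ₀)
  let w : Fin (k + 2) → ℝ := fun _ => min γ (min γ₁ γ₀)
  have hw : w ∈ Box γ (k + 1) := mem_box.mpr fun _ => ⟨ht0, min_le_left _ _⟩
  have hw₁ : w ∈ Box γ₁ (k + 1) := mem_box.mpr fun _ => ⟨ht0, (min_le_right _ _).trans (min_le_left _ _)⟩
  have hw₀ : Fin.tail w ∈ Box γ₀ k := mem_box.mpr fun _ => ⟨ht0, (min_le_right _ _).trans (min_le_right _ _)⟩
  have h1 : |β (k + 1) w - β k (Fin.tail w)| ≤ c * ρ ^ k := h k w hw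
  have h2 : |β (k + 1) w - b (k + 1)| ≤ ε / 2 := hA₁ w hw₁
  have h3 : |β k (Fin.tail w) - b k| ≤ ε / 2 := hA₀ (Fin.tail w) hw₀
  rw [abs_le] at h1 h2 h3 ⊢
  constructor <;> linarith [h1.1, h1.2, h2.1, h2.2, h3.1, h3.2]

/-- **N17 + anchor ⟹ the anchoring numbers CONVERGE GEOMETRICALLY** to some `b_∞` (geometric Cauchy; `ℝ` complete): the (AF-0r) shape for the corner values, reference free.
[cite: Balaban1987RG1, (1.20)-(1.22) p.264 and (2.13) p.268] -/
theorem tendsto_of_scaleShiftRate_scaleAnchor {c ρ γ : ℝ} (hγ : 0 < γ) (hρ1 : ρ < 1) (hb : ScaleAnchor β b) (h : ScaleShiftRate c ρ γ β) :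
    ∃ binf : ℝ, Tendsto b atTop (𝓝 binf) ∧ ∀ k, |b k - binf| ≤ c / (1 - ρ) * ρ ^ k := by
  have hstep : ∀ n, dist (b n) (b (n + 1)) ≤ c * ρ ^ n := fun n => by
    rw [Real.dist_eq, abs_sub_comm]
    exact abs_step_le_of_scaleShiftRate_scaleAnchor hγ hb h n
  obtain ⟨binf, hlim⟩ := cauchySeq_tendsto_of_complete (cauchySeq_of_le_geometric ρ c hρ1 hstep)
  refine ⟨binf, hlim, fun k => ?_⟩
  have hk := dist_le_of_le_geometric_of_tendsto ρ c hρ1 hstep hlim k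
  rwa [Real.dist_eq, ← div_mul_eq_mul_div] at hk

/-- TELESCOPING of the re-based remainder `β_k(v) − b_k` along the ladder: its scale shift is `≤ 2c·ρ^k` (N17 + the corner step), so a bound `e` at depth `k₀` on `]0,δ]^{k₀+1}`
(`δ ≤ γ`) propagates to `e + Σ_{j<m} 2c ρ^{k₀+j}` at depth `k₀ + m` on `]0,δ]^{k₀+m+1}`. [folklore] -/
theorem rebased_iterate {c ρ γ δ : ℝ} (hγ : 0 < γ) (hb : ScaleAnchor β b) (h : ScaleShiftRate c ρ γ β) (hδ : δ ≤ γ) (k₀ : ℕ) {e : ℝ}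
    (hbase : ∀ v ∈ Box δ k₀, |β k₀ v - b k₀| ≤ e) :
    ∀ m : ℕ, ∀ v ∈ Box δ (k₀ + m), |β (k₀ + m) v - b (k₀ + m)| ≤ e + ∑ j ∈ range m, 2 * c * ρ ^ (k₀ + j) := by
  intro m
  induction m with
  | zero => intro v hv; simpa using hbase v hv
  | succ m ih =>
    intro v hv
    have hs : |β (k₀ + m + 1) v - β (k₀ + m) (Fin.tail v)| ≤ c * ρ ^ (k₀ + m) := h (k₀ + m) v (box_mono hδ _ hv)
    have hbs : |b (k₀ + m + 1) - b (k₀ + m)| ≤ c * ρ ^ (k₀ + m) := abs_step_le_of_scaleShiftRate_scaleAnchor hγ hb h (k₀ + m)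
    have htail : Fin.tail v ∈ Box δ (k₀ + m) := mem_box.mpr fun i => (mem_box.mp hv) i.succ
    have ht : |β (k₀ + m) (Fin.tail v) - b (k₀ + m)| ≤ e + ∑ j ∈ range m, 2 * c * ρ ^ (k₀ + j) := ih (Fin.tail v) htail
    show |β (k₀ + m + 1) v - b (k₀ + m + 1)| ≤ e + ∑ j ∈ range (m + 1), 2 * c * ρ ^ (k₀ + j)
    rw [Finset.sum_range_succ]; rw [abs_le] at hs hbs ht ⊢
    constructor <;> linarith [hs.1, hs.2, hbs.1, hbs.2, ht.1, ht.2]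

/-- Geometric tail `Σ_{j<m} ρ^j ≤ (1 − ρ)⁻¹`. [folklore] -/
theorem geom_tail_le {ρ : ℝ} (hρ0 : 0 ≤ ρ) (hρ1 : ρ < 1) (m : ℕ) : ∑ j ∈ range m, ρ ^ j ≤ (1 - ρ)⁻¹ := by
  simpa [← Finset.range_eq_Ico] using geom_sum_Ico_le_of_lt_one (m := 0) (n := m) hρ0 hρ1

/-- **EVERY HEIGHT (idea-7's every-slope telescoping, reference free): N17 + anchor ⟹ for every `s > 0` a level `0 < γ_s ≤ γ` with `|β_k(v) − b_k| ≤ s` at EVERY scale on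
`]0,γ_s]^{k+1}`** — tail `k > k₀` by telescoping (`2cρ^{k₀}∕(1−ρ) ≤ s∕2`), head `k ≤ k₀` by the finitely many anchors. [cite: Balaban1987RG1, (1.20)-(1.22) p.264 and (2.13) p.268] -/
theorem everyHeight_of_scaleShiftRate_scaleAnchor {c ρ γ : ℝ} (hγ : 0 < γ) (hρ0 : 0 ≤ ρ) (hρ1 : ρ < 1) (hb : ScaleAnchor β b) (h : ScaleShiftRate c ρ γ β)
    {s : ℝ} (hs : 0 < s) : ∃ γs : ℝ, 0 < γs ∧ γs ≤ γ ∧ ∀ k, ∀ v ∈ Box γs k, |β k v - b k| ≤ s := by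
  have hc : 0 ≤ c := T4BetaStationary.constant_nonneg_of_scaleShiftRate h hγ
  have h1 : 0 < 1 - ρ := by linarith
  set ε : ℝ := s / 2 * (1 - ρ) / (2 * c + 1) with hε
  have hεpos : 0 < ε := by positivity
  obtain ⟨k₀, hk₀⟩ := exists_pow_lt_of_lt_one hεpos hρ1
  obtain ⟨δ, hδ, ha⟩ := scaleAnchor_upTo hb k₀ (half_pos hs)
  refine ⟨min δ γ, lt_min hδ hγ, min_le_right _ _, fun k v hv => ?_⟩
  have hvδ : v ∈ Box δ k := box_mono (min_le_left _ _) k hv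
  rcases Nat.lt_or_ge k₀ k with hk | hk
  · obtain ⟨m, rfl⟩ := Nat.exists_eq_add_of_le hk.le
    have hiter := rebased_iterate hγ hb h (min_le_right δ γ) k₀ (fun v hv => ha k₀ le_rfl v (box_mono (min_le_left _ _) _ hv)) m v hv
    have htail : ∑ j ∈ range m, 2 * c * ρ ^ (k₀ + j) ≤ s / 2 := by
      have hsum : ∑ j ∈ range m, 2 * c * ρ ^ (k₀ + j) = 2 * c * ρ ^ k₀ * ∑ j ∈ range m, ρ ^ j := by
        rw [Finset.mul_sum]; exact Finset.sum_congr rfl fun j _ => by rw [pow_add]; ring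
      rw [hsum]
      have hpk : 0 ≤ ρ ^ k₀ := pow_nonneg hρ0 k₀
      calc 2 * c * ρ ^ k₀ * ∑ j ∈ range m, ρ ^ j
          ≤ 2 * c * ρ ^ k₀ * (1 - ρ)⁻¹ := mul_le_mul_of_nonneg_left (geom_tail_le hρ0 hρ1 m) (mul_nonneg (by positivity) hpk)
        _ ≤ (2 * c + 1) * ε * (1 - ρ)⁻¹ := by
            apply mul_le_mul_of_nonneg_right _ (inv_nonneg.mpr h1.le)
            calc 2 * c * ρ ^ k₀ ≤ (2 * c + 1) * ρ ^ k₀ := by nlinarith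
              _ ≤ (2 * c + 1) * ε := mul_le_mul_of_nonneg_left hk₀.le (by linarith)
        _ = s / 2 := by rw [hε]; field_simp
    linarith
  · exact (ha k hk v hvδ).trans (half_le_self hs.le)

/-- **★ N17 + THE PER-SCALE ANCHOR MANUFACTURE DEF-1's CONSTANT REMAINDER `ConstRemainder β b s γ_s` AT EVERY HEIGHT `s > 0`** on some level `0 < γ_s ≤ γ` (idea-7 §8.1, re-based
on `ScaleAnchor`): the k-UNIFORM conjunct of `RemAt` ∕ `RunRemAt` — with ANY positive cap — carries no content beyond N17 + the identification; t-SLACK is moot on this road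
(CRIT-2 2f check 3). [cite: Balaban1987RG1, (1.20)-(1.22) p.264, (2.12)-(2.14) p.268 and (5.10) p.293] -/
theorem constRemainder_of_scaleShiftRate_scaleAnchor {c ρ γ : ℝ} (hγ : 0 < γ) (hρ0 : 0 ≤ ρ) (hρ1 : ρ < 1) (hb : ScaleAnchor β b) (h : ScaleShiftRate c ρ γ β)
    {s : ℝ} (hs : 0 < s) : ∃ γs : ℝ, 0 < γs ∧ γs ≤ γ ∧ ConstRemainder β b s γs := by
  obtain ⟨γs, hγs, hle, hrem⟩ := everyHeight_of_scaleShiftRate_scaleAnchor hγ hρ0 hρ1 hb h hs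
  exact ⟨γs, hγs, hle, fun k p hp => hrem k p ((histBox_eq_box γs k) ▸ hp)⟩

/-- **GEOMETRIC CONVERGENCE IS A TWO-SIDED DRIFT AT THE LIMIT SLOPE**: `|b_k − b_∞| ≤ C ρ^k` (`0 ≤ ρ < 1`, `0 ≤ C`) gives `|Σ_{j<k} b_j − b_∞·k| ≤ C∕(1−ρ)` for every `k` —
the shape `OneLoopDrift b_∞ (C·(1−ρ)⁻¹) b` of DEF-1's consumer.  (Why the sign road and the drift road meet at one consumer.) [cite: Balaban1988RG2Cluster, Lemma 3 (2.38) p.20] -/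
theorem oneLoopDrift_of_geometric {binf C ρ : ℝ} (hρ0 : 0 ≤ ρ) (hρ1 : ρ < 1) (hC : 0 ≤ C) (hrate : ∀ k, |b k - binf| ≤ C * ρ ^ k) :
    OneLoopDrift binf (C * (1 - ρ)⁻¹) b := by
  intro k
  have e : ∑ j ∈ range k, b j - binf * k = ∑ j ∈ range k, (b j - binf) := by
    rw [Finset.sum_sub_distrib, Finset.sum_const, Finset.card_range, nsmul_eq_mul, mul_comm]
  rw [e]
  calc |∑ j ∈ range k, (b j - binf)| ≤ ∑ j ∈ range k, |b j - binf| := Finset.abs_sum_le_sum_abs _ _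
    _ ≤ ∑ j ∈ range k, C * ρ ^ j := Finset.sum_le_sum fun j _ => hrate j
    _ = C * ∑ j ∈ range k, ρ ^ j := by rw [Finset.mul_sum]
    _ ≤ C * (1 - ρ)⁻¹ := mul_le_mul_of_nonneg_left (geom_tail_le hρ0 hρ1 k) hC

/-- **★ THE SIGN ROAD's END (forward-generated constructions): N17 + the history moduli + an anchor to θ-covariantly NAMED numbers `cβ • b0` (`cβ > 0`) EVENTUALLY `≥ e > 0`**
⟹ `EndpointExistence`: the corner values converge geometrically to `b_∞ ≥ cβ·e > 0` (`ge_of_tendsto`), which IS a drift at slope `b_∞` (`oneLoopDrift_of_geometric`); constant remainder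
at height `b_∞` (cap `le_rfl`), box (C) from the moduli (`T4BetaStationary.betaContH_of_histLipschitz`), DEF-1's consumer `endpointExistence_of_drift_constRemainder_cont` (p593586) BY
NAME.  CRIT-2 2c∕2e's corner road; split-free, `v₀`-free, no `stepBal`.  CONDITIONAL. [cite: Balaban1987RG1, Thm 2 p.259 (first sentence), (1.20)-(1.22) p.264, (2.13) p.268 and (5.10) p.293] -/
theorem endpointExistence_of_letters_scaleAnchor_eventuallyPos {Cn : B12.Construction} (hgen : ForwardGenerated Cn β) {c ρ γ : ℝ} {Λ : ℕ → ℕ → ℝ}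
    (hγ : 0 < γ) (hρ0 : 0 ≤ ρ) (hρ1 : ρ < 1) (h : ScaleShiftRate c ρ γ β) (hL : HistLipschitz Λ γ β)
    {b0 : ℕ → ℝ} {cβ e : ℝ} (hcβ : 0 < cβ) (he : 0 < e) (hA : ScaleAnchor β (fun k => cβ * b0 k)) (hev : ∃ k₀ : ℕ, ∀ k, k₀ ≤ k → e ≤ b0 k) :
    EndpointExistence Cn := by
  have hc : 0 ≤ c := T4BetaStationary.constant_nonneg_of_scaleShiftRate h hγ
  obtain ⟨binf, hlim, hrate⟩ := tendsto_of_scaleShiftRate_scaleAnchor hγ hρ1 hA h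
  obtain ⟨k₀, hk₀⟩ := hev
  have hev' : ∀ᶠ k in atTop, cβ * e ≤ cβ * b0 k :=
    Filter.eventually_atTop.mpr ⟨k₀, fun k hk => mul_le_mul_of_nonneg_left (hk₀ k hk) hcβ.le⟩
  have hpos : 0 < binf := lt_of_lt_of_le (mul_pos hcβ he) (ge_of_tendsto hlim hev')
  have hC : 0 ≤ c / (1 - ρ) := div_nonneg hc (by linarith)
  obtain ⟨γs, hγs, hle, hrem⟩ := constRemainder_of_scaleShiftRate_scaleAnchor hγ hρ0 hρ1 hA h hpos
  exact endpointExistence_of_drift_constRemainder_cont hgen hγs (oneLoopDrift_of_geometric hρ0 hρ1 hC hrate) hrem le_rfl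
    fun k => (T4BetaStationary.betaContH_of_histLipschitz hL k).mono (box_mono hle k)

/-- The Cesàro averages of a drifting sequence tend to the slope: `|Σ_{j<n} b_j − s·n| ≤ A` gives `|n⁻¹ Σ_{j<n} b_j − s| ≤ A∕n → 0`. [folklore] -/
theorem tendsto_avg_of_oneLoopDrift {b0 : ℕ → ℝ} {s A : ℝ} (h : OneLoopDrift s A b0) :
    Tendsto (fun n : ℕ => (n⁻¹ : ℝ) * ∑ i ∈ range n, b0 i) atTop (𝓝 s) := by
  refine tendsto_sub_nhds_zero_iff.mp (squeeze_zero_norm' ?_ (tendsto_const_div_atTop_nhds_zero_nat A))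
  filter_upwards [eventually_gt_atTop 0] with n hn
  have hn' : (0 : ℝ) < n := by exact_mod_cast hn
  show |(n⁻¹ : ℝ) * ∑ i ∈ range n, b0 i - s| ≤ A / n
  rw [show (n⁻¹ : ℝ) * ∑ i ∈ range n, b0 i - s = (n⁻¹ : ℝ) * (∑ i ∈ range n, b0 i - s * n) by
    rw [mul_sub, mul_comm s, inv_mul_cancel_left₀ hn'.ne'], abs_mul, abs_of_pos (inv_pos.mpr hn'), div_eq_inv_mul]
  exact mul_le_mul_of_nonneg_left (h n) (inv_nonneg.mpr hn'.le)

/-- **THE CESÀRO JUNCTION (idea-7 §8.2): under N17 + an anchor to `cβ • b0` (`cβ > 0`), a DRIFT of `b0` at slope `s` forces `b0_k → s`** — the anchoring numbers converge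
(N17), so do `b0` and its Cesàro means (`Filter.Tendsto.cesaro`); the drift sends the means to `s`; limits are unique.  (D1)'s drift PINS the corner values' limit.
[cite: Balaban1987RG1, (1.3) p.260 and (1.20)-(1.22) p.264] -/
theorem tendsto_of_scaleAnchor_drift {c ρ γ cβ s A : ℝ} {b0 : ℕ → ℝ} (hγ : 0 < γ) (hρ1 : ρ < 1) (h : ScaleShiftRate c ρ γ β) (hcβ : 0 < cβ)
    (hA : ScaleAnchor β (fun k => cβ * b0 k)) (hdrift : OneLoopDrift s A b0) : Tendsto b0 atTop (𝓝 s) := by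
  obtain ⟨L, hL, -⟩ := tendsto_of_scaleShiftRate_scaleAnchor hγ hρ1 hA h
  have hb0 : Tendsto b0 atTop (𝓝 (cβ⁻¹ * L)) := by
    refine (hL.const_mul cβ⁻¹).congr fun k => ?_
    show cβ⁻¹ * (cβ * b0 k) = b0 k
    rw [← mul_assoc, inv_mul_cancel₀ hcβ.ne', one_mul]
  have hLs : cβ⁻¹ * L = s := tendsto_nhds_unique hb0.cesaro (tendsto_avg_of_oneLoopDrift hdrift)
  rw [hLs] at hb0
  exact hb0

/-- … hence, for a POSITIVE slope, `b0_k ≥ s∕2` EVENTUALLY: the eventual-sign text is the WEAKER ask than (D1)'s drift, given N17 + the anchor. [cite: Balaban1987RG1, (1.3) p.260] -/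
theorem eventually_ge_of_scaleAnchor_drift {c ρ γ cβ s A : ℝ} {b0 : ℕ → ℝ} (hγ : 0 < γ) (hρ1 : ρ < 1) (h : ScaleShiftRate c ρ γ β) (hcβ : 0 < cβ)
    (hA : ScaleAnchor β (fun k => cβ * b0 k)) (hdrift : OneLoopDrift s A b0) (hs : 0 < s) : ∃ k₀ : ℕ, ∀ k, k₀ ≤ k → s / 2 ≤ b0 k :=
  Filter.eventually_atTop.mp <| (tendsto_of_scaleAnchor_drift hγ hρ1 h hcβ hA hdrift).eventually (eventually_ge_nhds (half_lt_self hs))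

end Generic

/-! ## §2 At NODE 00's Stage-13 record (`N = 2`), POINTWISE in the tuple: the letters `RemAt` ∕ `RunRemAt F κ θ hP θ.cβ` MANUFACTURED; the END from the drift or from the sign -/

section Record

variable (F : T4Family) (κ : StepColourData) (θ : Node00.Stage13HParams F 2) (hP : θ.Provisos₁₃SepCoPH F 2)

/-- **★ v5∕v6's XL LETTER MANUFACTURED, per tuple: `RemAt F κ θ hP θ.cβ` (DEF-1 ed.3, p593586) from K3⁷'s two letters on the datum's β (N17 `ScaleShiftRate c ρ θ.γ`, `0 ≤ ρ < 1`;
`HistLipschitz Λ θ.γ`) and THE PER-SCALE IDENTIFICATION ALONE** — constant remainder at the height of the cap itself (`s := θ.cβ·stepBal 2 F.L > 0`, Stage-9 chart clause +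
`stepBal_pos`; cap `le_rfl`), box (C) from the moduli, level `γ_s ≤ θ.γ` (idea-7 §8.3; CRIT-2 2f «given U3, 2′ ⟺ the identification»).  Three hypothesis shapes in, one out; nothing of
Bałaban asserted. [cite: Balaban1987RG1, (1.20)-(1.22) p.264 and (2.12)-(2.14) p.268] -/
theorem remAt_of_letters_scaleAnchor (hθ : θ.Admissible F 2) {c ρ : ℝ} {Λ : ℕ → ℕ → ℝ} (hρ0 : 0 ≤ ρ) (hρ1 : ρ < 1)
    (hss : ScaleShiftRate c ρ θ.γ (Node00.datumOfRecord₁₃SepCoPH F 2 θ hP).βfun) (hL : HistLipschitz Λ θ.γ (Node00.datumOfRecord₁₃SepCoPH F 2 θ hP).βfun)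
    (hA : ScaleAnchor (Node00.datumOfRecord₁₃SepCoPH F 2 θ hP).βfun (fun k => θ.cβ * beta0OfJs F κ k)) : RemAt F κ θ hP θ.cβ := by
  have hγ : 0 < θ.γ := hθ.toStage12.toStage9.gamma_pos
  have hs : 0 < θ.cβ * B12Normalization.stepBal 2 (F.L : ℝ) :=
    mul_pos hθ.toStage9.chart.1 (B12Normalization.stepBal_pos two_pos (by exact_mod_cast F.hL.2))
  obtain ⟨γs, hγs, hle, hrem⟩ := constRemainder_of_scaleShiftRate_scaleAnchor hγ hρ0 hρ1 hA hss hs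
  exact ⟨γs, θ.cβ * B12Normalization.stepBal 2 (F.L : ℝ), hγs, hle, le_rfl, hrem, hA,
    fun k => (T4BetaStationary.betaContH_of_histLipschitz hL k).mono (box_mono hle k)⟩

/-- **… and DEF-1's RUN EDITION `RunRemAt F κ θ hP θ.cβ` (p596574; v6's REGISTERED XL currency 2ᴮ″) follows** (`runRemAt_of_remAt`): on the corner road the run re-keying of
NODE O's wall changes nothing node O owes (CRIT-2 2f check 5). [cite: Balaban1987RG1, Thm 3 p.264 and (2.13) p.268] -/
theorem runRemAt_of_letters_scaleAnchor (hθ : θ.Admissible F 2) {c ρ : ℝ} {Λ : ℕ → ℕ → ℝ} (hρ0 : 0 ≤ ρ) (hρ1 : ρ < 1)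
    (hss : ScaleShiftRate c ρ θ.γ (Node00.datumOfRecord₁₃SepCoPH F 2 θ hP).βfun) (hL : HistLipschitz Λ θ.γ (Node00.datumOfRecord₁₃SepCoPH F 2 θ hP).βfun)
    (hA : ScaleAnchor (Node00.datumOfRecord₁₃SepCoPH F 2 θ hP).βfun (fun k => θ.cβ * beta0OfJs F κ k)) : RunRemAt F κ θ hP θ.cβ :=
  runRemAt_of_remAt F κ θ hP (remAt_of_letters_scaleAnchor F κ θ hP hθ hρ0 hρ1 hss hL hA)

/-- **★ THE END AT ONE TUPLE FROM K3⁷'s LETTERS, THE IDENTIFICATION AND (D1)'s DRIFT** of the bare named numbers at slope `stepBal 2 F.L` — the letter manufactured (★ above), then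
DEF-1's `endpointExistence_of_remAt_drift` BY NAME; the use form a LINE-2 skeleton concluder calls per tuple.  CONDITIONAL; K2⁷ NOT closed. [cite: Balaban1987RG1, Thm 2 p.259 (first sentence), (2.12)-(2.14) p.268 and (5.10) p.293] -/
theorem endpointExistence_of_letters_scaleAnchor_drift (hθ : θ.Admissible F 2) {c ρ : ℝ} {Λ : ℕ → ℕ → ℝ} (hρ0 : 0 ≤ ρ) (hρ1 : ρ < 1)
    (hss : ScaleShiftRate c ρ θ.γ (Node00.datumOfRecord₁₃SepCoPH F 2 θ hP).βfun) (hL : HistLipschitz Λ θ.γ (Node00.datumOfRecord₁₃SepCoPH F 2 θ hP).βfun)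
    (hA : ScaleAnchor (Node00.datumOfRecord₁₃SepCoPH F 2 θ hP).βfun (fun k => θ.cβ * beta0OfJs F κ k))
    {A : ℝ} (hdrift : OneLoopDrift (B12Normalization.stepBal 2 F.L) A (beta0OfJs F κ)) :
    EndpointExistence (Node00.datumOfRecord₁₃SepCoPH F 2 θ hP).C.toB12 :=
  endpointExistence_of_remAt_drift F κ θ hP (remAt_of_letters_scaleAnchor F κ θ hP hθ hρ0 hρ1 hss hL hA) hdrift

/-- **★ THE END AT ONE TUPLE FROM K3⁷'s LETTERS, THE IDENTIFICATION AND THE EVENTUAL SIGN** of the bare named numbers (CRIT-2 2e §B's (D1)-sign spelling) — §1's sign road at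
the datum (`D.fwd`, `0 < θ.cβ`, `0 < θ.γ`).  Split-free, `v₀`-free, no `stepBal`.  CONDITIONAL; K2⁷ NOT closed. [cite: Balaban1987RG1, Thm 2 p.259 (first sentence), (1.20)-(1.22) p.264 and (2.13) p.268] -/
theorem endpointExistence_of_letters_scaleAnchor_sign (hθ : θ.Admissible F 2) {c ρ : ℝ} {Λ : ℕ → ℕ → ℝ} (hρ0 : 0 ≤ ρ) (hρ1 : ρ < 1)
    (hss : ScaleShiftRate c ρ θ.γ (Node00.datumOfRecord₁₃SepCoPH F 2 θ hP).βfun) (hL : HistLipschitz Λ θ.γ (Node00.datumOfRecord₁₃SepCoPH F 2 θ hP).βfun)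
    (hA : ScaleAnchor (Node00.datumOfRecord₁₃SepCoPH F 2 θ hP).βfun (fun k => θ.cβ * beta0OfJs F κ k))
    {e : ℝ} (he : 0 < e) (hev : ∃ k₀ : ℕ, ∀ k, k₀ ≤ k → e ≤ beta0OfJs F κ k) :
    EndpointExistence (Node00.datumOfRecord₁₃SepCoPH F 2 θ hP).C.toB12 :=
  endpointExistence_of_letters_scaleAnchor_eventuallyPos (Node00.datumOfRecord₁₃SepCoPH F 2 θ hP).fwd hθ.toStage12.toStage9.gamma_pos hρ0 hρ1 hss hL
    hθ.toStage9.chart.1 he hA hev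

/-- **(D1)'s DRIFT ⟹ THE EVENTUAL SIGN, per tuple, given N17 + the identification** (Cesàro junction, `e := stepBal 2 F.L ∕ 2 > 0`): the sign spelling is the WEAKER ask. [cite: Balaban1987RG1, (1.3) p.260] -/
theorem eventuallyPos_of_letters_scaleAnchor_drift (hθ : θ.Admissible F 2) {c ρ : ℝ} (hρ1 : ρ < 1)
    (hss : ScaleShiftRate c ρ θ.γ (Node00.datumOfRecord₁₃SepCoPH F 2 θ hP).βfun)
    (hA : ScaleAnchor (Node00.datumOfRecord₁₃SepCoPH F 2 θ hP).βfun (fun k => θ.cβ * beta0OfJs F κ k))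
    {A : ℝ} (hdrift : OneLoopDrift (B12Normalization.stepBal 2 F.L) A (beta0OfJs F κ)) :
    ∃ e : ℝ, 0 < e ∧ ∃ k₀ : ℕ, ∀ k, k₀ ≤ k → e ≤ beta0OfJs F κ k :=
  have hsb : 0 < B12Normalization.stepBal 2 (F.L : ℝ) := B12Normalization.stepBal_pos two_pos (by exact_mod_cast F.hL.2)
  ⟨_, half_pos hsb, eventually_ge_of_scaleAnchor_drift hθ.toStage12.toStage9.gamma_pos hρ1 hss hθ.toStage9.chart.1 hA hdrift hsb⟩

end Record

/-! ## §3 The LINE-2 texts INLINE at v6's keying (the crux's OWN prefix `(unity ∧ slots) → Admissible → (B) → window`) and the compositions to the crux decl BY NAME: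
U3ᴷ (K3⁷-SHARED; RHS of the landed U3 read-out `iff`) `… → ∃ c C ρ Λ, 0 ≤ c ∧ 0 < ρ ∧ ρ < 1 ∧ ScaleShiftRate c ρ θ.γ D.βfun ∧ HistLipschitz Λ θ.γ D.βfun ∧ FadingMemory C ρ Λ`; Anchorᴷ
(K2⁷-PRIVATE XL, ∃κ AFTER θ, `θ.cβ` carried) `… → ∃ κ, ScaleAnchor D.βfun (fun k => θ.cβ * beta0OfJs F κ k)`; 1ᴬ = v6's REGISTERED `D1AtAnchoredJets` VERBATIM (`Window13` unfolded);
Signᴷ `∀ F κ θ hP, … → ScaleAnchor … → ∃ e > 0, ∃ k₀, ∀ k ≥ k₀, e ≤ beta0OfJs F κ k`; 2ᴮ″ = v6's REGISTERED `RunRemAtSomeJets` VERBATIM `… → ∃ κ, RunRemAt F κ θ hP θ.cβ`. -/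

section Texts

/-- **★★★ THE CORNER LINE, concluding THE CRUX DECL BY NAME: U3ᴷ → Anchorᴷ → 1ᴬ (v6's REGISTERED (D1) text) → `EndpointGivenBR13SepCoPH`** — per tuple the U3 letters and the
identification manufacture `RemAt F κ θ hP θ.cβ`, the anchor feeds 1ᴬ for the bare drift, DEF-1's `endpointExistence_of_remAt_drift` concludes (CRIT-2 2f's recommended LINE 2
{`stub_u3Triple13K`, `stub_anchorSomeJets13K`, the registered (D1) stub}; idea-7 §8.7c).  CONDITIONAL on three hypothesis shapes; K2⁷ NOT closed; nothing of Bałaban asserted.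
[cite: Balaban1987RG1, Thm 2 p.259 (first sentence), (1.20)-(1.22) p.264, (2.12)-(2.14) p.268 and (5.10) p.293] -/
theorem EndpointGivenBR13SepCoPH_of_u3K_anchorK_d1AnchoredK
    (hU3 : ∀ (F : T4Family) (θ : Node00.Stage13HParams F 2) (hP : θ.Provisos₁₃SepCoPH F 2), (θ.ZhUnity F 2 ∧ θ.SlotsNondegenerate₁₃ F 2) → θ.Admissible F 2 →
      B16.EndStatementBPrinted (Node00.datumOfRecord₁₃SepCoPH F 2 θ hP).C → (∃ γ₁ : ℝ, 0 < γ₁ ∧ ∀ γ : ℝ, 0 < γ → γ ≤ γ₁ → ∃ P : B12.RunParams, 1 ≤ P.K ∧ ((Node00.datumOfRecord₁₃SepCoPH F 2 θ hP).C P).flow.InInterval γ P.K) →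
      ∃ (c C ρ : ℝ) (Λ : ℕ → ℕ → ℝ), 0 ≤ c ∧ 0 < ρ ∧ ρ < 1 ∧ ScaleShiftRate c ρ θ.γ (Node00.datumOfRecord₁₃SepCoPH F 2 θ hP).βfun ∧
        HistLipschitz Λ θ.γ (Node00.datumOfRecord₁₃SepCoPH F 2 θ hP).βfun ∧ T4CouplingMatching.FadingMemory C ρ Λ)
    (hA : ∀ (F : T4Family) (θ : Node00.Stage13HParams F 2) (hP : θ.Provisos₁₃SepCoPH F 2), (θ.ZhUnity F 2 ∧ θ.SlotsNondegenerate₁₃ F 2) → θ.Admissible F 2 →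
      B16.EndStatementBPrinted (Node00.datumOfRecord₁₃SepCoPH F 2 θ hP).C → (∃ γ₁ : ℝ, 0 < γ₁ ∧ ∀ γ : ℝ, 0 < γ → γ ≤ γ₁ → ∃ P : B12.RunParams, 1 ≤ P.K ∧ ((Node00.datumOfRecord₁₃SepCoPH F 2 θ hP).C P).flow.InInterval γ P.K) →
      ∃ κ : StepColourData, ScaleAnchor (Node00.datumOfRecord₁₃SepCoPH F 2 θ hP).βfun (fun k => θ.cβ * beta0OfJs F κ k))
    (hD1 : ∀ (F : T4Family) (κ : StepColourData) (θ : Node00.Stage13HParams F 2) (hP : θ.Provisos₁₃SepCoPH F 2), (θ.ZhUnity F 2 ∧ θ.SlotsNondegenerate₁₃ F 2) → θ.Admissible F 2 →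
      B16.EndStatementBPrinted (Node00.datumOfRecord₁₃SepCoPH F 2 θ hP).C → (∃ γ₁ : ℝ, 0 < γ₁ ∧ ∀ γ : ℝ, 0 < γ → γ ≤ γ₁ → ∃ P : B12.RunParams, 1 ≤ P.K ∧ ((Node00.datumOfRecord₁₃SepCoPH F 2 θ hP).C P).flow.InInterval γ P.K) →
      ScaleAnchor (Node00.datumOfRecord₁₃SepCoPH F 2 θ hP).βfun (fun k => θ.cβ * beta0OfJs F κ k) →
      ∃ A : ℝ, OneLoopDrift (B12Normalization.stepBal 2 F.L) A (beta0OfJs F κ)) :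
    Summit.QuantumFields.YangMills.Theses.BalabanUVNodes.EndpointGivenBR13SepCoPH := by
  intro F θ hP hU hθ hB hwin
  obtain ⟨c, -, ρ, Λ, -, hρ0, hρ1, hss, hL, -⟩ := hU3 F θ hP hU hθ hB hwin
  obtain ⟨κ, hanch⟩ := hA F θ hP hU hθ hB hwin
  obtain ⟨A, hdrift⟩ := hD1 F κ θ hP hU hθ hB hwin hanch
  exact endpointExistence_of_letters_scaleAnchor_drift F κ θ hP hθ hρ0.le hρ1 hss hL hanch hdrift

/-- **★★★ THE SIGN TWIN, concluding THE CRUX DECL BY NAME: U3ᴷ → Anchorᴷ → Signᴷ → `EndpointGivenBR13SepCoPH`** (CRIT-2 2e §B's v5 LINE 2 ∕ idea-7 §8.7d at v6's keying; Signᴷ is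
the WEAKER (D1) ask, `signK_of_u3K_d1AnchoredK`).  Split-free, `v₀`-free, no `ContRecord13`.  CONDITIONAL; K2⁷ NOT closed. [cite: Balaban1987RG1, Thm 2 p.259 (first sentence), (1.20)-(1.22) p.264 and (2.13) p.268] -/
theorem EndpointGivenBR13SepCoPH_of_u3K_anchorK_signK
    (hU3 : ∀ (F : T4Family) (θ : Node00.Stage13HParams F 2) (hP : θ.Provisos₁₃SepCoPH F 2), (θ.ZhUnity F 2 ∧ θ.SlotsNondegenerate₁₃ F 2) → θ.Admissible F 2 →
      B16.EndStatementBPrinted (Node00.datumOfRecord₁₃SepCoPH F 2 θ hP).C → (∃ γ₁ : ℝ, 0 < γ₁ ∧ ∀ γ : ℝ, 0 < γ → γ ≤ γ₁ → ∃ P : B12.RunParams, 1 ≤ P.K ∧ ((Node00.datumOfRecord₁₃SepCoPH F 2 θ hP).C P).flow.InInterval γ P.K) →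
      ∃ (c C ρ : ℝ) (Λ : ℕ → ℕ → ℝ), 0 ≤ c ∧ 0 < ρ ∧ ρ < 1 ∧ ScaleShiftRate c ρ θ.γ (Node00.datumOfRecord₁₃SepCoPH F 2 θ hP).βfun ∧
        HistLipschitz Λ θ.γ (Node00.datumOfRecord₁₃SepCoPH F 2 θ hP).βfun ∧ T4CouplingMatching.FadingMemory C ρ Λ)
    (hA : ∀ (F : T4Family) (θ : Node00.Stage13HParams F 2) (hP : θ.Provisos₁₃SepCoPH F 2), (θ.ZhUnity F 2 ∧ θ.SlotsNondegenerate₁₃ F 2) → θ.Admissible F 2 →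
      B16.EndStatementBPrinted (Node00.datumOfRecord₁₃SepCoPH F 2 θ hP).C → (∃ γ₁ : ℝ, 0 < γ₁ ∧ ∀ γ : ℝ, 0 < γ → γ ≤ γ₁ → ∃ P : B12.RunParams, 1 ≤ P.K ∧ ((Node00.datumOfRecord₁₃SepCoPH F 2 θ hP).C P).flow.InInterval γ P.K) →
      ∃ κ : StepColourData, ScaleAnchor (Node00.datumOfRecord₁₃SepCoPH F 2 θ hP).βfun (fun k => θ.cβ * beta0OfJs F κ k))
    (hs : ∀ (F : T4Family) (κ : StepColourData) (θ : Node00.Stage13HParams F 2) (hP : θ.Provisos₁₃SepCoPH F 2), (θ.ZhUnity F 2 ∧ θ.SlotsNondegenerate₁₃ F 2) → θ.Admissible F 2 →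
      B16.EndStatementBPrinted (Node00.datumOfRecord₁₃SepCoPH F 2 θ hP).C → (∃ γ₁ : ℝ, 0 < γ₁ ∧ ∀ γ : ℝ, 0 < γ → γ ≤ γ₁ → ∃ P : B12.RunParams, 1 ≤ P.K ∧ ((Node00.datumOfRecord₁₃SepCoPH F 2 θ hP).C P).flow.InInterval γ P.K) →
      ScaleAnchor (Node00.datumOfRecord₁₃SepCoPH F 2 θ hP).βfun (fun k => θ.cβ * beta0OfJs F κ k) →
      ∃ e : ℝ, 0 < e ∧ ∃ k₀ : ℕ, ∀ k, k₀ ≤ k → e ≤ beta0OfJs F κ k) :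
    Summit.QuantumFields.YangMills.Theses.BalabanUVNodes.EndpointGivenBR13SepCoPH := by
  intro F θ hP hU hθ hB hwin
  obtain ⟨c, -, ρ, Λ, -, hρ0, hρ1, hss, hL, -⟩ := hU3 F θ hP hU hθ hB hwin
  obtain ⟨κ, hanch⟩ := hA F θ hP hU hθ hB hwin
  obtain ⟨e, he, hev⟩ := hs F κ θ hP hU hθ hB hwin hanch
  exact endpointExistence_of_letters_scaleAnchor_sign F κ θ hP hθ hρ0.le hρ1 hss hL hanch he hev

/-- **★★ THE WALL LOCATED AT v6's KEYING: U3ᴷ → Anchorᴷ → 2ᴮ″ (= v6's REGISTERED XL stub text `RunRemAtSomeJets` :319 VERBATIM, `Window13` unfolded)** — given K3⁷'s letters, DEF-1's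
run letter at every guarded tuple IS the per-scale identification (idea-7 §8.7; CRIT-2 2f check 3); (B) and the window are unread. [cite: Balaban1987RG1, Thm 3 p.264, (1.20)-(1.22) p.264 and (2.13) p.268] -/
theorem runRemAtSomeJetsK_of_u3K_anchorK
    (hU3 : ∀ (F : T4Family) (θ : Node00.Stage13HParams F 2) (hP : θ.Provisos₁₃SepCoPH F 2), (θ.ZhUnity F 2 ∧ θ.SlotsNondegenerate₁₃ F 2) → θ.Admissible F 2 →
      B16.EndStatementBPrinted (Node00.datumOfRecord₁₃SepCoPH F 2 θ hP).C → (∃ γ₁ : ℝ, 0 < γ₁ ∧ ∀ γ : ℝ, 0 < γ → γ ≤ γ₁ → ∃ P : B12.RunParams, 1 ≤ P.K ∧ ((Node00.datumOfRecord₁₃SepCoPH F 2 θ hP).C P).flow.InInterval γ P.K) →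
      ∃ (c C ρ : ℝ) (Λ : ℕ → ℕ → ℝ), 0 ≤ c ∧ 0 < ρ ∧ ρ < 1 ∧ ScaleShiftRate c ρ θ.γ (Node00.datumOfRecord₁₃SepCoPH F 2 θ hP).βfun ∧
        HistLipschitz Λ θ.γ (Node00.datumOfRecord₁₃SepCoPH F 2 θ hP).βfun ∧ T4CouplingMatching.FadingMemory C ρ Λ)
    (hA : ∀ (F : T4Family) (θ : Node00.Stage13HParams F 2) (hP : θ.Provisos₁₃SepCoPH F 2), (θ.ZhUnity F 2 ∧ θ.SlotsNondegenerate₁₃ F 2) → θ.Admissible F 2 →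
      B16.EndStatementBPrinted (Node00.datumOfRecord₁₃SepCoPH F 2 θ hP).C → (∃ γ₁ : ℝ, 0 < γ₁ ∧ ∀ γ : ℝ, 0 < γ → γ ≤ γ₁ → ∃ P : B12.RunParams, 1 ≤ P.K ∧ ((Node00.datumOfRecord₁₃SepCoPH F 2 θ hP).C P).flow.InInterval γ P.K) →
      ∃ κ : StepColourData, ScaleAnchor (Node00.datumOfRecord₁₃SepCoPH F 2 θ hP).βfun (fun k => θ.cβ * beta0OfJs F κ k)) :
    ∀ (F : T4Family) (θ : Node00.Stage13HParams F 2) (hP : θ.Provisos₁₃SepCoPH F 2), (θ.ZhUnity F 2 ∧ θ.SlotsNondegenerate₁₃ F 2) → θ.Admissible F 2 →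
      B16.EndStatementBPrinted (Node00.datumOfRecord₁₃SepCoPH F 2 θ hP).C → (∃ γ₁ : ℝ, 0 < γ₁ ∧ ∀ γ : ℝ, 0 < γ → γ ≤ γ₁ → ∃ P : B12.RunParams, 1 ≤ P.K ∧ ((Node00.datumOfRecord₁₃SepCoPH F 2 θ hP).C P).flow.InInterval γ P.K) →
      ∃ κ : StepColourData, RunRemAt F κ θ hP θ.cβ := fun F θ hP hU hθ hB hwin => by
  obtain ⟨c, -, ρ, Λ, -, hρ0, hρ1, hss, hL, -⟩ := hU3 F θ hP hU hθ hB hwin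
  obtain ⟨κ, hanch⟩ := hA F θ hP hU hθ hB hwin
  exact ⟨κ, runRemAt_of_letters_scaleAnchor F κ θ hP hθ hρ0.le hρ1 hss hL hanch⟩

/-- (converse projection) **2ᴮ″ ⟹ Anchorᴷ**: v6's registered run letter CARRIES the identification as a conjunct — with `runRemAtSomeJetsK_of_u3K_anchorK` the locating equivalence
«given U3ᴷ: 2ᴮ″ ⟺ Anchorᴷ» (CRIT-2 2f check 3: the wall is LOCATED, not renamed). [folklore] -/
theorem anchorK_of_runRemAtSomeJetsK
    (h₂ : ∀ (F : T4Family) (θ : Node00.Stage13HParams F 2) (hP : θ.Provisos₁₃SepCoPH F 2), (θ.ZhUnity F 2 ∧ θ.SlotsNondegenerate₁₃ F 2) → θ.Admissible F 2 →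
      B16.EndStatementBPrinted (Node00.datumOfRecord₁₃SepCoPH F 2 θ hP).C → (∃ γ₁ : ℝ, 0 < γ₁ ∧ ∀ γ : ℝ, 0 < γ → γ ≤ γ₁ → ∃ P : B12.RunParams, 1 ≤ P.K ∧ ((Node00.datumOfRecord₁₃SepCoPH F 2 θ hP).C P).flow.InInterval γ P.K) →
      ∃ κ : StepColourData, RunRemAt F κ θ hP θ.cβ) :
    ∀ (F : T4Family) (θ : Node00.Stage13HParams F 2) (hP : θ.Provisos₁₃SepCoPH F 2), (θ.ZhUnity F 2 ∧ θ.SlotsNondegenerate₁₃ F 2) → θ.Admissible F 2 →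
      B16.EndStatementBPrinted (Node00.datumOfRecord₁₃SepCoPH F 2 θ hP).C → (∃ γ₁ : ℝ, 0 < γ₁ ∧ ∀ γ : ℝ, 0 < γ → γ ≤ γ₁ → ∃ P : B12.RunParams, 1 ≤ P.K ∧ ((Node00.datumOfRecord₁₃SepCoPH F 2 θ hP).C P).flow.InInterval γ P.K) →
      ∃ κ : StepColourData, ScaleAnchor (Node00.datumOfRecord₁₃SepCoPH F 2 θ hP).βfun (fun k => θ.cβ * beta0OfJs F κ k) :=
  fun F θ hP hU hθ hB hwin => by
  obtain ⟨κ, -, -, -, -, -, -, hanch, -⟩ := h₂ F θ hP hU hθ hB hwin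
  exact ⟨κ, hanch⟩

/-- **1ᴬ (v6's registered (D1) text) ⟹ Signᴷ, GIVEN U3ᴷ** (§2's Cesàro junction per tuple): the sign twin asks LESS of the (D1) owner than the registered drift text. [cite: Balaban1987RG1, (1.3) p.260] -/
theorem signK_of_u3K_d1AnchoredK
    (hU3 : ∀ (F : T4Family) (θ : Node00.Stage13HParams F 2) (hP : θ.Provisos₁₃SepCoPH F 2), (θ.ZhUnity F 2 ∧ θ.SlotsNondegenerate₁₃ F 2) → θ.Admissible F 2 →
      B16.EndStatementBPrinted (Node00.datumOfRecord₁₃SepCoPH F 2 θ hP).C → (∃ γ₁ : ℝ, 0 < γ₁ ∧ ∀ γ : ℝ, 0 < γ → γ ≤ γ₁ → ∃ P : B12.RunParams, 1 ≤ P.K ∧ ((Node00.datumOfRecord₁₃SepCoPH F 2 θ hP).C P).flow.InInterval γ P.K) →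
      ∃ (c C ρ : ℝ) (Λ : ℕ → ℕ → ℝ), 0 ≤ c ∧ 0 < ρ ∧ ρ < 1 ∧ ScaleShiftRate c ρ θ.γ (Node00.datumOfRecord₁₃SepCoPH F 2 θ hP).βfun ∧
        HistLipschitz Λ θ.γ (Node00.datumOfRecord₁₃SepCoPH F 2 θ hP).βfun ∧ T4CouplingMatching.FadingMemory C ρ Λ)
    (hD1 : ∀ (F : T4Family) (κ : StepColourData) (θ : Node00.Stage13HParams F 2) (hP : θ.Provisos₁₃SepCoPH F 2), (θ.ZhUnity F 2 ∧ θ.SlotsNondegenerate₁₃ F 2) → θ.Admissible F 2 →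
      B16.EndStatementBPrinted (Node00.datumOfRecord₁₃SepCoPH F 2 θ hP).C → (∃ γ₁ : ℝ, 0 < γ₁ ∧ ∀ γ : ℝ, 0 < γ → γ ≤ γ₁ → ∃ P : B12.RunParams, 1 ≤ P.K ∧ ((Node00.datumOfRecord₁₃SepCoPH F 2 θ hP).C P).flow.InInterval γ P.K) →
      ScaleAnchor (Node00.datumOfRecord₁₃SepCoPH F 2 θ hP).βfun (fun k => θ.cβ * beta0OfJs F κ k) →
      ∃ A : ℝ, OneLoopDrift (B12Normalization.stepBal 2 F.L) A (beta0OfJs F κ)) :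
    ∀ (F : T4Family) (κ : StepColourData) (θ : Node00.Stage13HParams F 2) (hP : θ.Provisos₁₃SepCoPH F 2), (θ.ZhUnity F 2 ∧ θ.SlotsNondegenerate₁₃ F 2) → θ.Admissible F 2 →
      B16.EndStatementBPrinted (Node00.datumOfRecord₁₃SepCoPH F 2 θ hP).C → (∃ γ₁ : ℝ, 0 < γ₁ ∧ ∀ γ : ℝ, 0 < γ → γ ≤ γ₁ → ∃ P : B12.RunParams, 1 ≤ P.K ∧ ((Node00.datumOfRecord₁₃SepCoPH F 2 θ hP).C P).flow.InInterval γ P.K) →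
      ScaleAnchor (Node00.datumOfRecord₁₃SepCoPH F 2 θ hP).βfun (fun k => θ.cβ * beta0OfJs F κ k) →
      ∃ e : ℝ, 0 < e ∧ ∃ k₀ : ℕ, ∀ k, k₀ ≤ k → e ≤ beta0OfJs F κ k := fun F κ θ hP hU hθ hB hwin hanch => by
  obtain ⟨c, -, ρ, Λ, -, -, hρ1, hss, -, -⟩ := hU3 F θ hP hU hθ hB hwin
  obtain ⟨A, hdrift⟩ := hD1 F κ θ hP hU hθ hB hwin hanch
  exact eventuallyPos_of_letters_scaleAnchor_drift F κ θ hP hθ hρ1 hss hanch hdrift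

end Texts

end Summit.QuantumFields.YangMills.Theorems.BalabanUVNodesK2CornerRoad
end
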